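import Summits.CriticalPhenomena.PercolationContinuityZ3.Theorems.Transplant.SkelFrm1ReachRadQ
import Summits.CriticalPhenomena.PercolationContinuityZ3.Theorems.Transplant.SkelFrm1ReachRowsQU
import Summits.CriticalPhenomena.PercolationContinuityZ3.Theorems.Transplant.SkelPhiReachRadiiQS
import Summits.CriticalPhenomena.PercolationContinuityZ3.Theorems.Transplant.SkelPhiNegReachDeepOS
import Summits.CriticalPhenomena.PercolationContinuityZ3.Theorems.Transplant.SkelFrmBParamsSlotsS
import Summits.CriticalPhenomena.PercolationContinuityZ3.Theorems.Transplant.SkelFrmBChoiceRadii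
import Summits.CriticalPhenomena.PercolationContinuityZ3.Theorems.Transplant.SkelFrmBChoiceDefs3
import Summits.CriticalPhenomena.PercolationContinuityZ3.Theorems.Transplant.SkelFrmBChoiceGeom
import Summits.CriticalPhenomena.PercolationContinuityZ3.Theorems.Transplant.SkelFrmBChoiceLinks
import Summits.CriticalPhenomena.PercolationContinuityZ3.Theorems.Transplant.SkelFrmBChoiceKit
import Summits.CriticalPhenomena.PercolationContinuityZ3.Theorems.Transplant.SkelFrmBChoiceZone
import Summits.CriticalPhenomena.PercolationContinuityZ3.Theorems.Transplant.SkelFrmBChoiceRooms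
import Summits.CriticalPhenomena.PercolationContinuityZ3.Theorems.Transplant.SkelFrmBChoiceNums
import Summits.CriticalPhenomena.PercolationContinuityZ3.Theorems.Transplant.SkelFrmBParamsSchedA
import Summits.CriticalPhenomena.PercolationContinuityZ3.Theorems.Transplant.SkelFrmBParamsCorrKG
import HarnessLib

/-!
(J17 / (R-39): the UNION-PRISM twin of the second-axis half of SkelFrm1ReachRadQ — `reachOblAtHNF_frmQ3R_sndU` over `reachOblAtHNF_frmQ3D_sndU`
(schedule `kgCorrSchedYU`, PER-REGION reading rows `hPR`); text otherwise verbatim.)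
# N2 (frames-only node `SamePDropOfSkeletonFrm₁`, OPEN), (C) column: THE CORRIDOR RESIDUE AT ONE PROBE OF A RUN WITH THE RADIUS ROWS AND THE ENTRANCE
# DEPTH DISCHARGED — `PlanarSkeletonFrm.NegB.reachOblAtHNF_frmQ3R_fst/_snd` (fibre block of record `SUS ex mx`; J15's exhibited instance)

Over `reachOblAtHNF_frmQ3D_fst/_snd` (SkelFrm1ReachRowsQD): at a CHOSEN probe of a RUN of the scheme of record the radii are realised
(`reach_radii_concSG₂NbS`: `rQ α x = rB α v e.2 = E`, `ρ β x du = E − 2`, `rM β (x+du) = F(nQ+1) − Lp`, `nQ α x = nS α v + 1`, `E ≥ E₀ + cOffS·‖x‖₁`,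
`E := Erad (gap SUS) 0 (E₀ SUS) (nQ α x)`), the explored neighbours of the fresh world are `E' := E(nS α v)`-deep (`deep_of_run₂bOS`), so with the window
radius `R := E − 3`, the entrance depth `R₀ := E'`, the excess radius `R₁ := Rex E'` (`hR₁_US` at the oriented long map `φL = oriφ Φ.φ (oL …)`, fine
diameter `50·rmax` through `fine_diam_le_mRS`), the world rows of SkelFrmBChoiceRooms (`Rw := E`, `m′ := 25·rmax`, `ctr := cenS x`) and
`E = E' + gap E'` (`Erad_succ`, `gap' = 0`), every radius/depth/world binder of the D-wrappers is discharged; what remains per probe is the K-G row set +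
`N`, THREE FLOORS — (ρ1) `r₀0 RL + 3 ≤ E₀`, (ρ2) `13·(prism box depth) + 4 ≤ E₀`, (ρ3) `∀ k, Rex (E k) + r₀0 RL + 3 ≤ gap (E k)` — the reading/start-box rows
and the budget (stmt-g20's Window/Readings/Len).
builds on p205010 (kernel theorem, internal audit signed; external expert review pending) — nothing in this file uses p205010; nothing here is a claim
about the open node `SamePDropOfSkeletonFrm₁`.
Lane `prim-bschramm`, seat `prim-bschramm-p5` (gen 16; (C) lineage); helper file (`--supports stmt-CriticalPhenomena-4575 --as helper`).
[cite: KozmaNitzan2024, §4 Lemma 12 (pp. 23–25), pp. 25–27, p. 30 (Step IV)] [cite: MartineauTassion2017, §4.3 Lemma 4.2]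
-/

noncomputable section

open MeasureTheory ProbabilityTheory
open scoped ENNReal Classical

namespace Summit.CriticalPhenomena.PercolationContinuityZ3.Theorems.Transplant

namespace PlanarSkeletonFrm

open Literature.Probability.Percolation Literature.Probability.LatticeModels SimpleGraph GadgetSystem ProbeHistory HSiteScheme Contour KNCells
open Literature.Probability.Percolation.KozmaNitzan.Cells (oth sgOf)
open KNCells.KSchA KNLevels ChainPlanar ChainPara
open Literature.Barriers.CriticalPhenomena (HasExponentialGrowth graphBall graphBall_mono mem_graphBall_self)
open Skel (ReachOblAtHNF excess)
open SkelI (tanOff)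
open SkelConc (Consts)
open BoxProdZ2 (ConcRadiiG)
open TwoAxis.Para (modulus)
open Skelφ (oriφ trφ)
open Skelφ.StepI (DataN DataNS OutNS)
open BoxProdZ2 (Erad nQ nS)

namespace NegB

open Neg

section Rad

variable {κ : Consts} {V : Type} [DecidableEq V] [Countable V] {G : SimpleGraph V} [G.LocallyFinite] {Φ : PlanarSkeletonFrm G} {t : V} {p : unitInterval}
  {hC : Φ.CylSubcritical p} {gv fv : Neg.FSlot} {Pv : PSlot} {ex mx : GSlot} {cv : CSlot} {bv : BSlot} {O : OutNS V} {q : unitInterval}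

local notation "g°" => gOf κ Φ t p O gv
local notation "f°" => fOf κ Φ t p O fv
local notation "c°" => cOf κ Φ t p O gv fv cv
local notation "nL°" => nL κ Φ t p O.merged g° f°
local notation "ℓL°" => ℓL κ Φ t p O.merged g° f°
local notation "hL°" => hL κ Φ t p O.merged g° f°
local notation "vL°" => vL κ Φ t p O.merged g° f°
local notation "vβL°" => vβL κ Φ t p O.merged g° f°
local notation "φL°" => φL κ Φ t p O.D O.DT.toDataN O.ori g° f°
local notation "ψ°" => fineOA κ Φ t p O.D O.DT.toDataN O.ori g° f°
local notation "P°" => fcellsS κ Φ t p O.merged g° f° c°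
local notation "Sᵘ" => SUS ex mx κ Φ t p O.merged g° f° q
local notation "Λ°" => schedOfS κ Φ t p O.merged g° f° c° Sᵘ
local notation "b°" => bOf κ Φ t p O gv fv bv
local notation "F°" => prFA κ Φ t p O.merged g° f°
local notation "S°" => (KSchA.mk (ΓQ κ Φ t p O gv fv (SUS ex mx) cv bv q) q κ.δ : KSchA V ℕ)
local notation "FD°" => FDQ κ Φ t p O gv fv (SUS ex mx) cv q
local notation "e₀" => (((0 : Fin 2), true) : MDir)
local notation "e₁" => (((1 : Fin 2), true) : MDir)

set_option maxHeartbeats 800000 in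
/-- **THE (C) RESIDUE OF THE CHOICE FUNCTION OF RECORD AT ONE PROBE OF A RUN, SECOND AXIS, RADII AND DEPTH DISCHARGED** (fibre block `SUS ex mx`):
window radius `R := E(nQ α x) − 3`, entrance depth `R₀ := E(nS α v)` (`deep_of_run₂bOS`), excess radius `R₁ := Rex R₀` (`hR₁_US`), world rows from
SkelFrmBChoiceRooms with `φe :=` the fine map and `m := 50·rmax` (`fine_diam_le_mRS`); left: the K-G row set + `N`, three `E₀`/`gap` floors, the reading
and start-box rows, the budget. [cite: KozmaNitzan2024, §4 Lemma 12 (pp. 23–25), p. 30 (Step IV)] -/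
theorem reachOblAtHNF_frmQ3R_sndU (hAt : (choiceAtQ3 κ Φ t p Pv gv fv (SUS ex mx) cv bv hC).AtQNQ O q) (h1 : Φ.types = {t})
    (hp0 : 0 < (p : ℝ)) (hp1 : (p : ℝ) < 1) (mk : ℕ)
    -- the probe, ON A RUN, CHOSEN
    {h : ProbeHistory V} {e : Site 2 × MDir} (hrun : (S°).IsRun₂O G h) (hc : ((S°).astOf₂O G h).st.ochoice KSchA.qNE = some e)
    (hV : (S°).Valid₂O G h e) (hdu : e₁ ∈ (S°).onwardO G h (tgt e)) (hne : e₁ ≠ rev e.2)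
    -- the corridor of record
    {ρ qq W : ℕ} (HK : Skelφ.KGYRows nL° ℓL° hL° vL° (KS0.R'0 κ Φ t p O.merged mk) ρ qq W) (N : ℕ)
    -- THE THREE RADIUS FLOORS (ρ1) kit threshold, (ρ2) prism depth, (ρ3) excess inside one gap
    (hρ1 : KS0.r₀0 t O.merged mk (RL κ Φ t p O gv fv) + 3 ≤ Skelφ.Prm.E₀ Sᵘ)
    (hρ2 : (13 : ℤ) * (((N : ℤ) + 1) * ((nL° * ℓL° / Skelφ.shearUnit nL° hL° + 1 : ℕ) : ℤ) + Skelφ.kgZY₀ nL° vL° (KS0.R'0 κ Φ t p O.merged mk) ρ W N (Skelφ.kgM₁Y nL° vL° (KS0.R'0 κ Φ t p O.merged mk) ρ W N) (Skelφ.kgWm₂Y nL° vL° (KS0.R'0 κ Φ t p O.merged mk) ρ W N) (Skelφ.kgWp₂Y nL° vL° (KS0.R'0 κ Φ t p O.merged mk) ρ W N) (Skelφ.kgM₂Y nL° ℓL° hL° vL° (KS0.R'0 κ Φ t p O.merged mk) ρ qq W N) + Skelφ.kgZY₁ nL° ℓL° hL° (KS0.R'0 κ Φ t p O.merged mk) ρ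 qq N (Skelφ.kgM₁Y nL° vL° (KS0.R'0 κ Φ t p O.merged mk) ρ W N) (Skelφ.kgM₂Y nL° ℓL° hL° vL° (KS0.R'0 κ Φ t p O.merged mk) ρ qq W N)) + 4 ≤ (Skelφ.Prm.E₀ Sᵘ : ℤ))
    (hρ3 : ∀ k : ℕ, Sᵘ.Rex (Erad (Skelφ.Prm.gap Sᵘ) (fun _ => 0) (Skelφ.Prm.E₀ Sᵘ) k) + KS0.r₀0 t O.merged mk (RL κ Φ t p O gv fv) + 3 ≤
      Skelφ.Prm.gap Sᵘ (Erad (Skelφ.Prm.gap Sᵘ) (fun _ => 0) (Skelφ.Prm.E₀ Sᵘ) k))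
    -- PER-REGION READING ROWS of the second-axis corridor (J17)
    (hPR : ∀ k ≤ (Skelφ.kgCorrSchedY HK.hn HK.hv HK.hlay (HK.kgYVals_ok₁ N) (HK.kgYVals_ok₂ N) (HK.kgYVals_split N)).N, ∃ lo hi : Site 2,
      (Skelφ.kgCorrSchedY HK.hn HK.hv HK.hlay (HK.kgYVals_ok₁ N) (HK.kgYVals_ok₂ N) (HK.kgYVals_split N)).region k ⊆ Finset.Icc lo hi ∧
      (-(5 * ((P°).r 1 : ℤ)) + 1 ≤ Skelφ.rdLo (F°).A nL° hL° vL° vβL° (F°).c₀ (F°).c₁ (F°).D lo hi 1 ∧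
        Skelφ.rdHi (F°).A nL° hL° vL° vβL° (F°).c₀ (F°).c₁ (F°).D lo hi 1 ≤ 22 * ((P°).r 1 : ℤ) - 1) ∧
      (-(2 * ((P°).r 0 : ℤ)) + 1 ≤ Skelφ.rdLo (F°).A nL° hL° vL° vβL° (F°).c₀ (F°).c₁ (F°).D lo hi 0 ∧
        Skelφ.rdHi (F°).A nL° hL° vL° vβL° (F°).c₀ (F°).c₁ (F°).D lo hi 0 ≤ 2 * ((P°).r 0 : ℤ) - 1))
    -- READING ROWS of the arrival box `[kgLastLoY, kgLastHiY]` (SkelPhiCorridorKGBoxes)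
    (hLl : 20 * ((P°).r 1 : ℤ) - b° 1 + 1 ≤ Skelφ.rdLo (F°).A nL° hL° vL° vβL° (F°).c₀ (F°).c₁ (F°).D (HK.kgLastLoY N) (HK.kgLastHiY N) 1 ∧
      5 * ((P°).r 1 : ℤ) ≤ Skelφ.rdLo (F°).A nL° hL° vL° vβL° (F°).c₀ (F°).c₁ (F°).D (HK.kgLastLoY N) (HK.kgLastHiY N) 1 ∧
      Skelφ.rdHi (F°).A nL° hL° vL° vβL° (F°).c₀ (F°).c₁ (F°).D (HK.kgLastLoY N) (HK.kgLastHiY N) 1 ≤ 20 * ((P°).r 1 : ℤ) + b° 1 - 1 ∧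
      Skelφ.rdHi (F°).A nL° hL° vL° vβL° (F°).c₀ (F°).c₁ (F°).D (HK.kgLastLoY N) (HK.kgLastHiY N) 1 ≤ 22 * ((P°).r 1 : ℤ))
    (hLt : PCells2S.cenS P° (tgt e + stepVec e₁) 0 - PCells2S.cenS P° (tgt e) 0 - b° 0 + 1 ≤ Skelφ.rdLo (F°).A nL° hL° vL° vβL° (F°).c₀ (F°).c₁ (F°).D (HK.kgLastLoY N) (HK.kgLastHiY N) 0 ∧
      Skelφ.rdHi (F°).A nL° hL° vL° vβL° (F°).c₀ (F°).c₁ (F°).D (HK.kgLastLoY N) (HK.kgLastHiY N) 0 ≤ PCells2S.cenS P° (tgt e + stepVec e₁) 0 - PCells2S.cenS P° (tgt e) 0 + b° 0 - 1 ∧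
      -(2 * ((P°).r 0 : ℤ)) ≤ Skelφ.rdLo (F°).A nL° hL° vL° vβL° (F°).c₀ (F°).c₁ (F°).D (HK.kgLastLoY N) (HK.kgLastHiY N) 0 ∧
      Skelφ.rdHi (F°).A nL° hL° vL° vβL° (F°).c₀ (F°).c₁ (F°).D (HK.kgLastLoY N) (HK.kgLastHiY N) 0 ≤ 2 * ((P°).r 0 : ℤ))
    -- START-BOX ROWS (`aW ≤ (n ± v) + W`, `bL ≤ qq`)
    {aW Bx bL : ℤ} (ha : (F°).D * ((F°).c₁ * (nL° : ℤ) * (b° 0 + 1) + (F°).c₀ * |vL°| * (b° 1 + 1)) ≤ (F°).c₀ * (F°).c₁ * (F°).A * modulus nL° hL° vL° vβL° * aW)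
    (hBx : (F°).D * ((b° 1 : ℤ) + 1) ≤ (F°).c₁ * (F°).A * Bx) (hbL : Bx / (Skelφ.shearUnit nL° hL° : ℤ) + 1 ≤ bL)
    (haW : aW ≤ ((((nL° : ℤ) + vL°).toNat + W : ℕ) : ℤ)) (haW' : aW ≤ ((((nL° : ℤ) - vL°).toNat + W : ℕ) : ℤ)) (hbq : bL ≤ qq)
    -- the budget
    {nmax : ℕ} (hnmax : (Skelφ.kgCorrSchedYU HK.hn HK.hv HK.hlay (HK.kgYVals_ok₁ N) (HK.kgYVals_ok₂ N) (HK.kgYVals_split N)).N ≤ nmax) :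
    ReachOblAtHNF G nmax S° FD° Φ.Δ (κ.δr 0) h e ((S°).aOf₂O G h e) e₁ := by
  obtain ⟨ω, n, rfl⟩ := hrun
  -- the long clause and its numerics
  have hN := eqNumL_of_atQ hAt
  obtain ⟨hn1, hℓ1⟩ := one_le_of_eqNumL κ Φ t p O.merged g° f° hN
  have hκL := (clauseL_of_atQ hAt).2
  obtain ⟨-, -, -, hCq⟩ := factsNS_of_atQ hAt
  have hlipφ := lip_φL κ Φ t p O.D O.DT.toDataN O.ori g° f°
  have hstep := steps_φL κ Φ t p O.D O.DT.toDataN O.ori g° f°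
  have hlipψ : Skelφ.Lip G ψ° := lip_fineA_at κ Φ t p O.merged g° f° hlipφ hN
  have hwsψ : Skelφ.WeakSteps G ψ° := weakSteps_fineA_at κ Φ t p O.merged g° f° hstep hN
  have hψ0 : ψ° t = 0 := fineA_base_at κ Φ t p O.merged g° f° _ hN
  have hΛ : Skelφ.WFS2 (P°).toPCells2 Λ° := schedOfS_WFS2 κ Φ t p O.merged g° f° c° Sᵘ
  have hcolQ : ∀ a x, ∃ y ∈ Skelφ.VWin G ψ° t ((P°).Q x) ((Λ°).rQ a x), ψ° y = (P°).cenS x :=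
    hcol_fineA_of_schedS κ Φ t p O.merged g° f° c° hlipφ hstep hN (colQ_schedOfS κ Φ t p O.merged g° f° c° Sᵘ)
  have hgap := hgap20_US κ Φ t p O.merged g° f° ex mx q
  have hgapc := hgapc_US κ Φ t p O.merged g° f° ex mx q
  have hgapL := hgapL_US κ Φ t p O.merged g° f° ex mx q
  have hoff := offNS_le κ Φ t p O.merged g° f° c° hN hκL
  have hE3 := (three_le_E₀_US κ Φ t p O.merged g° f° ex mx q).1
  have hc' : (((S°).scheme₂O G).ostN KSchA.qNE n ω).ochoice KSchA.qNE = some e := by rw [KSchA.stN_eq₂O]; exact hc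
  -- THE RADII AT THE PROBE (realised anchors)
  obtain ⟨hrQ, hrB, hρ, -, hrM, hQS, hxn⟩ := Skelφ.reach_radii_concSG₂NbS (ψ := ψ°) (P := P°) (t := t) (gap := Skelφ.Prm.gap Sᵘ) (gap' := fun _ => 0)
    (E₀ := Skelφ.Prm.E₀ Sᵘ) (L' := Skelφ.Prm.Lp Sᵘ) (off := offNS κ Φ t p O.merged g° f° c°) (b₀ := b°) (q := q) (δc := κ.δ)
    hgap hgapc hoff (by omega) hψ0 hc hV hdu
  obtain ⟨hDQ, hDρ', hρM, hlin⟩ := Skelφ.reach_radius_rows_concSG₂NbS (ψ := ψ°) (P := P°) (t := t) (gap := Skelφ.Prm.gap Sᵘ)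
    (E₀ := Skelφ.Prm.E₀ Sᵘ) (L' := Skelφ.Prm.Lp Sᵘ) (off := offNS κ Φ t p O.merged g° f° c°) (b₀ := b°) (q := q) (δc := κ.δ)
    hgap hgapc hgapL hoff hE3 hψ0 hc hV hdu
  -- THE ENTRANCE DEPTH ALONG THE RUN
  have hdeep := Skelφ.deep_of_run₂bOS hlipψ hwsψ P° t (Skelφ.Prm.gap Sᵘ) (fun _ => 0) (Skelφ.Prm.E₀ Sᵘ) (Skelφ.Prm.Lp Sᵘ)
    (offNS κ Φ t p O.merged g° f° c°) q κ.δ b° hΛ hψ0 hgap hgapc hoff (by omega) hcolQ ω n hc' hdu ((S°).aOf₂O G ((S°).hst₂O G ω n) e)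
  -- the levels, and the radii facts in the scheme-of-record form (definitional unfoldings of `ΓQ`/`schedOfS`/`FDQ`)
  set E := Erad (Skelφ.Prm.gap Sᵘ) (fun _ => 0) (Skelφ.Prm.E₀ Sᵘ) (nQ ((S°).aOf₁O G ((S°).hst₂O G ω n) e) (tgt e)) with hEdef
  set E' := Erad (Skelφ.Prm.gap Sᵘ) (fun _ => 0) (Skelφ.Prm.E₀ Sᵘ) (nS ((S°).aOf₁O G ((S°).hst₂O G ω n) e) e.1) with hE'def
  have hEE₀ : Skelφ.Prm.E₀ Sᵘ ≤ E := Skel.E₀_le_Erad _ _ _ _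
  have hE'E₀ : Skelφ.Prm.E₀ Sᵘ ≤ E' := Skel.E₀_le_Erad _ _ _ _
  have hrQ' : (Λ°).rQ ((S°).aOf₁O G ((S°).hst₂O G ω n) e) (tgt e) = E := hrQ
  have hrB' : (Λ°).rB ((S°).aOf₁O G ((S°).hst₂O G ω n) e) e.1 e.2 = E := hrB
  have hρ' : ∀ ℓ, (Λ°).ρ ((S°).aOf₂O G ((S°).hst₂O G ω n) e) (tgt e) e₁ ℓ = E - 2 := hρ
  have hQS' : nQ ((S°).aOf₁O G ((S°).hst₂O G ω n) e) (tgt e) = nS ((S°).aOf₁O G ((S°).hst₂O G ω n) e) e.1 + 1 := hQS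
  have hlin' : Skelφ.Prm.E₀ Sᵘ + cOffS κ Φ t p O.merged g° f° * (((tgt e) 0).natAbs + ((tgt e) 1).natAbs) ≤ E := hlin
  have hDQ' : E - 3 + 1 ≤ (Λ°).rQ ((S°).aOf₁O G ((S°).hst₂O G ω n) e) (tgt e) := hDQ
  have hDρ'' : ∀ ℓ, E - 3 + 1 ≤ (Λ°).ρ ((S°).aOf₂O G ((S°).hst₂O G ω n) e) (tgt e) e₁ ℓ := hDρ'
  have hρM' : ∀ ℓ, (Λ°).ρ ((S°).aOf₂O G ((S°).hst₂O G ω n) e) (tgt e) e₁ ℓ + 1 ≤ (Λ°).rM ((S°).aOf₂O G ((S°).hst₂O G ω n) e) (tgt e + stepVec e₁) := hρM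
  have hdeep' : ∀ a ∈ (S°).Vx G ((S°).hst₂O G ω n), ∀ b ∈ (S°).Γ.Ewv ((S°).aOf₁O G ((S°).hst₂O G ω n) e) e.1 e.2 ∪
      (FD°).Hfull ((S°).aOf₂O G ((S°).hst₂O G ω n) e) (tgt e) e₁, b ∉ (S°).Vx G ((S°).hst₂O G ω n) → G.Adj a b → a ∈ graphBall G t E' := hdeep
  have hEsucc : E = E' + Skelφ.Prm.gap Sᵘ E' := by
    rw [hEdef, hQS', BoxProdZ2.Erad_succ, BoxProdZ2.Frad_succ, ← hE'def]; simp
  have hρ3' : Sᵘ.Rex E' + KS0.r₀0 t O.merged mk (RL κ Φ t p O gv fv) + 3 ≤ Skelφ.Prm.gap Sᵘ E' := hρ3 _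
  -- the tolerance of the excess device
  have hη' : Neg.η κ Φ ≤ κ.δr 0 / 2 := by
    have h2 := (Neg.η_pos κ Φ).2.2
    have hk := Neg.δkit_le_δr κ Φ (n := 0) (by norm_num)
    linarith
  refine reachOblAtHNF_frmQ3D_sndU hAt h1 hp0 hp1 mk hV hdu hne HK N (R := E - 3) ?_ hDQ' hDρ'' hρM' (R₀ := E') hdeep'
    hPR hLl hLt ha hBx hbL haW haW' hbq ?_
    (φe := ψ°) (Rw := E) (m' := 25 * (P°).rmax) (m := 50 * (fcellsA κ Φ t p O.merged g° f°).rmax) (R₁ := Sᵘ.Rex E')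
    (ctr := PCells2S.cenS P° (tgt e)) ?_ ?_ ?_ ?_ ?_ hnmax
  · -- hr₀R : r₀0 ≤ E − 3
    omega
  · -- hRD : (cOffS‖x‖₁ + 1) + 13·(box) ≤ E − 3
    set Zb : ℤ := (((N : ℤ) + 1) * ((nL° * ℓL° / Skelφ.shearUnit nL° hL° + 1 : ℕ) : ℤ) + Skelφ.kgZY₀ nL° vL° (KS0.R'0 κ Φ t p O.merged mk) ρ W N (Skelφ.kgM₁Y nL° vL° (KS0.R'0 κ Φ t p O.merged mk) ρ W N) (Skelφ.kgWm₂Y nL° vL° (KS0.R'0 κ Φ t p O.merged mk) ρ W N) (Skelφ.kgWp₂Y nL° vL° (KS0.R'0 κ Φ t p O.merged mk) ρ W N) (Skelφ.kgM₂Y nL° ℓL° hL° vL° (KS0.R'0 κ Φ t p O.merged mk) ρ qq W N) + Skelφ.kgZY₁ nL° ℓL° hL° (KS0.R'0 κ Φ t p O.merged mk) ρ qq N (Skelφ.kgM₁Y nL° vL° (KS0.R'0 κ Φ t p O.merged mk) ρ W N) (Skelφ.kgM₂Y nL° ℓL° hL° vL° (KS0.R'0 κ Φ t p O.merged mk) ρ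 qq W N)) with hZb
    have hcast : (((E - 3 : ℕ)) : ℤ) = (E : ℤ) - 3 := by omega
    rw [hcast]
    have hlinZ : ((Skelφ.Prm.E₀ Sᵘ : ℕ) : ℤ) + ((cOffS κ Φ t p O.merged g° f° * (((tgt e) 0).natAbs + ((tgt e) 1).natAbs) + 1 : ℕ) : ℤ) ≤ (E : ℤ) + 1 := by
      have := hlin'; push_cast at this ⊢; linarith
    linarith [hρ2, hlinZ]
  · -- hWπ : the world lies in `B(t, E)`
    intro b hb
    exact Skelφ.mem_graphBall_of_mem_Ewv_Hfull₂bS (le_of_eq hrB') (le_of_eq hrQ') (fun ℓ => (le_of_eq (hρ' ℓ)).trans (Nat.sub_le _ _)) hb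
  · -- hWpl : planar footprints in `cenS x + Λ_(25·rmax)`
    intro b hb
    exact Skelφ.ψ_mem_box_image_of_mem_Ewv_Hfull₂bS hb
  · -- hm
    show 2 * (25 * (fcellsA κ Φ t p O.merged g° f°).rmax) ≤ 50 * (fcellsA κ Φ t p O.merged g° f°).rmax
    omega
  · -- hR₁ : the excess device at entrance depth `E' + 1`, fine-map diameter `50·rmax`
    intro R'' hR'' Rw' D' A' hD' hdiam hAD hA
    exact hR₁_US κ Φ t p O.merged g° f° ex mx q hCq (oL κ Φ t p O.D O.DT.toDataN O.ori g° f°) hη' t E' R'' hR'' Rw' D' A' hD'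
      (fun d hd d' hd' => fine_diam_le_mRS κ Φ t p O.merged g° f° (mx κ Φ t p O.merged g° f°) hN (hdiam d hd d' hd')) hAD hA
  · -- hR₁R : Rex E' ≤ (E − 3) − r₀0  (one gap absorbs the excess)
    omega

end Rad

end NegB

end PlanarSkeletonFrm

end Summit.CriticalPhenomena.PercolationContinuityZ3.Theorems.Transplant

end
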